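import Summits.RiemannHypothesis.RiemannHypothesis.Theorems.WeilArchIncrementOneNodeCorr
import HarnessLib

/-!
# One-node certification of a window increment polynomial, II: the kernel certificate (Cauchy root bound)

RH-free helper for the GroundBarta A-layers (`--supports` the parity ladder item); part II of II
(part I: `WeilArchIncrementOneNodeCorr.lean` — the correlation polynomial `corrPoly`, its common denominator and
coefficient bound, and the Cauchy root bound).  A windowed trial vector
`v(x) = P(x/b)·𝟙_{[-b,b]}` enters the pole / prime / archimedean enclosures through its INCREMENT polynomial `E`,
tied to `P` by the identity `τ·E(τ) = d(0) − d(τ)`, `d = 2 · Poly.corr P P 1` (the window autocorrelation).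
`Literature/…/ExpPoly/CorrelationCert.lean` certifies a candidate `E` by `L > deg` point checks
`Poly.incCheckAt P E 1 (j/64)` (interpolation; for the `c = 83/100` cell: 113 nodes per vector = the `…N01/…N23`
files, ≈ 500 s of kernel time and two gate files per vector).

THIS FILE replaces the `L` nodes by ONE node.  The residual `R = X·E + 2(C − C(0))`, `C(t) = ∫_{-1}^{1-t} P(x+t)P(x) dx`,
is a polynomial with an explicit common denominator `S = Sp² · lcm(1,…,2|P|)` (`Sp` clears the denominators of `P`)
and explicitly bounded scaled coefficients `|S·r_k| ≤ B` (`corrPoly`, `corrPoly_coeff_int_bound`, `incR_coeff_int_bound`);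
by the Cauchy root bound (`eq_zero_of_eval_eq_zero_of_coeff_bound`) a rational zero `t₀ ≥ B + 2` of `R` forces `R = 0`.
So the Boolean certificate `incCheckBig P E` — cheap side conditions plus the single point check at
`t₀ = incPoint P E` (an integer of a few hundred digits; the kernel's GMP arithmetic makes the point size immaterial) —
implies the identity for all real `τ` (`inc_identity_of_incCheckBig`, same conclusion as `Poly.inc_identity_of_checks`
with `b = 1`).  Measured (farm, vector `ne83v1`, degree 54/110): one node 6–8 s whether `t₀ = 37/64` or `10^400`;
the whole certificate ≈ 10 s instead of 113 nodes.

USAGE (generated A-layer finals): replace the interpolation proof of `<v>_hE` by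
`inc_identity_of_incCheckBig <v>P <v>E (by decide +kernel)`.

References: Cauchy's bound on the roots of a polynomial [folklore]; Lagrange interpolation is no longer used.
-/

set_option linter.dupNamespace false

open Polynomial Finset

namespace Summit.RiemannHypothesis.RiemannHypothesis.Theorems.IncOneNode

/-! ## The residual polynomial `R = X·E + 2 (C − C(0))` and the kernel check -/

section Check

open Literature.Analysis.ValidatedNumerics.ExpPoly

/-- `Σ_k E_k X^k` — a coefficient list as an element of `ℚ[X]`. [folklore] -/
noncomputable def listPoly (E : Poly) : ℚ[X] := ∑ k ∈ range E.length, C (E.getD k 0) * X ^ k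

/-- `listPoly E` evaluates like the list. [folklore] -/
theorem aeval_listPoly (E : Poly) (t : ℝ) : aeval t (listPoly E) = Poly.eval E t := by
  rw [Poly.eval_eq_sum_getD]
  simp [listPoly, map_sum, map_mul, map_pow, aeval_X, aeval_C]

/-- Coefficients of `listPoly`. [folklore] -/
theorem coeff_listPoly (E : Poly) (k : ℕ) : (listPoly E).coeff k = E.getD k 0 := by
  simp only [listPoly, finsetSum_coeff, coeff_C_mul_X_pow]
  rw [Finset.sum_ite_eq]
  split_ifs with h
  · rfl
  · rw [List.getD_eq_default _ _ (by simpa using h)]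

/-- The residual `R = X · E + 2 · (corrPoly − corrPoly(0))`; the increment identity says `R = 0`. [folklore] -/
noncomputable def incR (p E : Poly) : ℚ[X] :=
  X * listPoly E + C 2 * (corrPoly p - C ((corrPoly p).coeff 0))

/-- `(corrPoly p)(0) = eval (corr p p 1) 0` in `ℝ`. [folklore] -/
theorem cast_coeff_zero_corrPoly (p : Poly) :
    (((corrPoly p).coeff 0 : ℚ) : ℝ) = Poly.eval (Poly.corr p p 1) 0 := by
  rw [Polynomial.coeff_zero_eq_eval_zero, ← aeval_corrPoly_eq_eval_corr]
  have h := Polynomial.aeval_algebraMap_apply_eq_algebraMap_eval (A := ℝ) (0 : ℚ) (corrPoly p)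
  simp only [map_zero, eq_ratCast] at h
  exact h.symm

/-- **Meaning of `R`**: `R(t) = t·E(t) − (d(0) − d(t))`, `d = 2 · corr p p 1`. [folklore] -/
theorem aeval_incR (p E : Poly) (t : ℝ) :
    aeval t (incR p E) = t * Poly.eval E t -
      (Poly.eval (Poly.smul 2 (Poly.corr p p 1)) 0 - Poly.eval (Poly.smul 2 (Poly.corr p p 1)) t) := by
  simp only [incR, map_add, map_mul, map_sub, aeval_X, aeval_C, eq_ratCast, aeval_listPoly,
    aeval_corrPoly_eq_eval_corr, cast_coeff_zero_corrPoly, Poly.eval_smul]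
  push_cast
  ring

/-- `((R.eval t₀ : ℚ) : ℝ) = aeval (t₀ : ℝ) R`. [folklore] -/
theorem cast_eval_incR (p E : Poly) (t₀ : ℚ) :
    (((incR p E).eval t₀ : ℚ) : ℝ) = aeval (t₀ : ℝ) (incR p E) := by
  have h := Polynomial.aeval_algebraMap_apply_eq_algebraMap_eval (A := ℝ) t₀ (incR p E)
  simp only [eq_ratCast] at h
  exact h.symm

/-- **Scaled coefficients of `R`: integers of bounded size.** [folklore] -/
theorem incR_coeff_int_bound {p E : Poly} {Sp L M ME : ℕ}
    (hp : ∀ i, i < p.length → (∃ z : ℤ, (z : ℚ) = p.getD i 0 * Sp) ∧ |p.getD i 0| * Sp ≤ M)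
    (hL : ∀ m, 1 ≤ m → m ≤ 2 * p.length → m ∣ L)
    (hE : ∀ k, (∃ z : ℤ, (z : ℚ) = E.getD k 0 * ((Sp : ℚ) ^ 2 * L)) ∧
      |E.getD k 0| * ((Sp : ℚ) ^ 2 * L) ≤ ME) (k : ℕ) :
    (∃ z : ℤ, (z : ℚ) = ((Sp : ℚ) ^ 2 * L) * (incR p E).coeff k) ∧
      |((Sp : ℚ) ^ 2 * L) * (incR p E).coeff k| ≤
        (ME : ℚ) + 4 * ((M : ℚ) ^ 2 * L * (p.length : ℚ) ^ 3 * 8 ^ p.length) := by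
  have hBC0 : (0 : ℚ) ≤ (M : ℚ) ^ 2 * L * (p.length : ℚ) ^ 3 * 8 ^ p.length := by positivity
  have hME0 : (0 : ℚ) ≤ ME := by positivity
  cases k with
  | zero =>
      have h0 : (incR p E).coeff 0 = 0 := by
        simp [incR, coeff_sub, coeff_C]
      rw [h0, mul_zero]
      exact ⟨⟨0, by simp⟩, by rw [abs_zero]; positivity⟩
  | succ k =>
      have h1 : (incR p E).coeff (k + 1) = E.getD k 0 + 2 * (corrPoly p).coeff (k + 1) := by
        simp [incR, coeff_X_mul, coeff_listPoly, coeff_C_mul, coeff_sub]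
      rw [h1, mul_add]
      obtain ⟨⟨zE, hzE⟩, hbE⟩ := hE k
      obtain ⟨⟨zC, hzC⟩, hbC⟩ := corrPoly_coeff_int_bound hp hL (k + 1)
      have e1 : ((Sp : ℚ) ^ 2 * L) * E.getD k 0 = zE := by rw [hzE]; ring
      have e2 : ((Sp : ℚ) ^ 2 * L) * (2 * (corrPoly p).coeff (k + 1)) = 2 * zC := by rw [hzC]; ring
      rw [e1, e2]
      refine ⟨⟨zE + 2 * zC, by push_cast; ring⟩, ?_⟩
      have hbE' : |(zE : ℚ)| ≤ ME := by
        rw [hzE, abs_mul, abs_of_nonneg (by positivity : (0 : ℚ) ≤ (Sp : ℚ) ^ 2 * L)]; exact hbE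
      have hbC' : |(zC : ℚ)| ≤ (M : ℚ) ^ 2 * L * (p.length : ℚ) ^ 3 * 8 ^ p.length := by rw [hzC]; exact hbC
      calc |(zE : ℚ) + 2 * zC| ≤ |(zE : ℚ)| + |2 * (zC : ℚ)| := abs_add_le _ _
        _ = |(zE : ℚ)| + 2 * |(zC : ℚ)| := by rw [abs_mul]; norm_num
        _ ≤ ME + 2 * ((M : ℚ) ^ 2 * L * (p.length : ℚ) ^ 3 * 8 ^ p.length) := by gcongr
        _ ≤ ME + 4 * ((M : ℚ) ^ 2 * L * (p.length : ℚ) ^ 3 * 8 ^ p.length) := by nlinarith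

/-! ### The kernel check -/

/-- `lcm` of the denominators of a coefficient list. [folklore] -/
def denLcm (p : Poly) : ℕ := p.foldr (fun q acc => Nat.lcm q.den acc) 1

/-- `lcm(1, …, m)`. [folklore] -/
def lcmUpTo (m : ℕ) : ℕ := (List.range' 1 m).foldr Nat.lcm 1

/-- `max_k |q_k · S|` (numerator size after scaling; a heuristic, re-checked by the certificate). [folklore] -/
def maxScaled (p : Poly) (S : ℕ) : ℕ := p.foldr (fun q acc => max (q * (S : ℚ)).num.natAbs acc) 0

/-- Denominator scale `Sp` of `p`. [folklore] -/
def incSp (p : Poly) : ℕ := denLcm p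
/-- `L = lcm(1, …, 2|p|)`. [folklore] -/
def incL (p : Poly) : ℕ := lcmUpTo (2 * p.length)
/-- The common scale `S = Sp² · L` of the residual polynomial. [folklore] -/
def incS (p : Poly) : ℕ := incSp p ^ 2 * incL p
/-- `M = max |p_i| Sp`. [folklore] -/
def incM (p : Poly) : ℕ := maxScaled p (incSp p)
/-- `ME = max |E_k| S`. [folklore] -/
def incME (p E : Poly) : ℕ := maxScaled E (incS p)
/-- The bound `B_C = M² L |p|³ 8^{|p|}` of the scaled correlation coefficients. [folklore] -/
def incBC (p : Poly) : ℕ := incM p ^ 2 * incL p * p.length ^ 3 * 8 ^ p.length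
/-- **The single evaluation point** `t₀ = ME + 4 B_C + 2` (beyond the Cauchy root bound). [folklore] -/
def incPoint (p E : Poly) : ℚ := ((incME p E + 4 * incBC p + 2 : ℕ) : ℚ)

/-- **The one-node increment certificate**: scale/divisibility/size side conditions (cheap) and ONE point check
`t₀ · E(t₀) = 2 C(0) − 2 C(t₀)` at `t₀ = incPoint p E`. [folklore] -/
def incCheckBig (p E : Poly) : Bool :=
  decide (0 < incSp p) && decide (0 < incL p) &&
  (List.range' 1 (2 * p.length)).all (fun m => incL p % m == 0) &&
  p.all (fun q => (q * (incSp p : ℚ)).den == 1 && decide (|q| * (incSp p : ℚ) ≤ incM p)) &&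
  E.all (fun e => (e * (incS p : ℚ)).den == 1 && decide (|e| * (incS p : ℚ) ≤ incME p E)) &&
  Poly.incCheckAt p E 1 (incPoint p E)

/-- A rational with denominator `1` is an integer. [folklore] -/
theorem exists_int_of_den_eq_one {q : ℚ} (h : q.den = 1) : ∃ z : ℤ, (z : ℚ) = q :=
  ⟨q.num, Rat.coe_int_num_of_den_eq_one h⟩

/-- **Soundness of the one-node certificate.**  If `incCheckBig p E` holds then for every real `t`,
`t · E(t) = d(0) − d(t)` with `d = 2 · corr p p 1` — the same conclusion as the `L`-node interpolation
certificate `Poly.inc_identity_of_checks` (with `b = 1`). [folklore] -/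
theorem inc_identity_of_incCheckBig (p E : Poly) (h : incCheckBig p E = true) (t : ℝ) :
    t * Poly.eval E t =
      Poly.eval (Poly.smul 2 (Poly.corr p p 1)) 0 - Poly.eval (Poly.smul 2 (Poly.corr p p 1)) t := by
  simp only [incCheckBig, Bool.and_eq_true, List.all_eq_true, decide_eq_true_eq, beq_iff_eq] at h
  obtain ⟨⟨⟨⟨⟨hSp, hL0⟩, hL⟩, hp⟩, hE⟩, hnode⟩ := h
  -- hypotheses in the shape of the coefficient lemmas
  have hp' : ∀ i, i < p.length →
      (∃ z : ℤ, (z : ℚ) = p.getD i 0 * (incSp p)) ∧ |p.getD i 0| * (incSp p) ≤ incM p := by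
    intro i hi
    have hmem : p.getD i 0 ∈ p := by rw [List.getD_eq_getElem _ _ hi]; exact List.getElem_mem hi
    obtain ⟨h1, h2⟩ := hp _ hmem
    exact ⟨exists_int_of_den_eq_one h1, h2⟩
  have hL' : ∀ m, 1 ≤ m → m ≤ 2 * p.length → m ∣ incL p := by
    intro m hm1 hm2
    have hmem : m ∈ List.range' 1 (2 * p.length) := by rw [List.mem_range'_1]; omega
    exact Nat.dvd_of_mod_eq_zero (hL m hmem)
  have hS : ((incS p : ℕ) : ℚ) = (incSp p : ℚ) ^ 2 * (incL p : ℚ) := by simp [incS]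
  have hE' : ∀ k, (∃ z : ℤ, (z : ℚ) = E.getD k 0 * ((incSp p : ℚ) ^ 2 * (incL p))) ∧
      |E.getD k 0| * ((incSp p : ℚ) ^ 2 * (incL p)) ≤ incME p E := by
    intro k
    rcases lt_or_ge k E.length with hk | hk
    · have hmem : E.getD k 0 ∈ E := by rw [List.getD_eq_getElem _ _ hk]; exact List.getElem_mem hk
      obtain ⟨h1, h2⟩ := hE _ hmem
      rw [hS] at h1 h2
      exact ⟨exists_int_of_den_eq_one h1, h2⟩
    · rw [List.getD_eq_default _ _ hk]
      exact ⟨⟨0, by simp⟩, by simp⟩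
  -- the residual vanishes at `t₀`
  have hev : (incR p E).eval (incPoint p E) = 0 := by
    have hq : incPoint p E * Poly.evalQ E (incPoint p E) =
        2 * Poly.corrAt p 1 0 - 2 * Poly.corrAt p 1 (incPoint p E) := by
      simpa [Poly.incCheckAt] using hnode
    have hr : ((incPoint p E : ℚ) : ℝ) * Poly.eval E (incPoint p E) =
        2 * Poly.eval (Poly.corr p p 1) 0 - 2 * Poly.eval (Poly.corr p p 1) (incPoint p E) := by
      have := congrArg (fun q : ℚ ↦ (q : ℝ)) hq
      simp only [Rat.cast_mul, Rat.cast_sub, Rat.cast_ofNat, Poly.eval_evalQ, Poly.corrAt_eq,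
        Rat.cast_zero] at this
      exact this
    have h1 : (((incR p E).eval (incPoint p E) : ℚ) : ℝ) = 0 := by
      rw [cast_eval_incR, aeval_incR, Poly.eval_smul, Poly.eval_smul, hr]
      push_cast
      ring
    exact_mod_cast h1
  -- Cauchy ⇒ `R = 0`
  have hSpos : 0 < incS p := by unfold incS; positivity
  have hR : incR p E = 0 := by
    refine eq_zero_of_eval_eq_zero_of_coeff_bound (incR p E) (S := incS p)
      (B := incME p E + 4 * incBC p) hSpos (fun k ↦ ?_) (fun k ↦ ?_) (t₀ := incPoint p E) ?_ hev
    · rw [hS]; exact (incR_coeff_int_bound hp' hL' hE' k).1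
    · rw [hS]
      refine (incR_coeff_int_bound hp' hL' hE' k).2.trans (le_of_eq ?_)
      simp [incBC]
    · simp [incPoint]
  -- read off the identity at `t`
  have h2 := aeval_incR p E t
  rw [hR, map_zero] at h2
  linarith

end Check

end Summit.RiemannHypothesis.RiemannHypothesis.Theorems.IncOneNode
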